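import Summits.CriticalPhenomena.PercolationContinuityZ3.Theorems.Transplant.SkelFrmFromBChoiceGeomV
import Summits.CriticalPhenomena.PercolationContinuityZ3.Theorems.Transplant.SkelFrmFromBChoiceDefsVPx
import HarnessLib

/-!
# GEN ROW (RULING D-Us, lead g21 V147b / Us-R1–R2 lead g22; WAVE-Us-MANIFEST v1.0 §5 — the GEOM column TOP) «SkelFrmFromBChoiceGeomVPx» — the GENERALISED twin of
# «SkelFrmFromBChoiceGeomV»'s `geomHoldsNQFn_frmChoiceAllQ3V` (U idx 81): **the geometric obligation of the GEN choice function of record at proxy radius `D`**,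
# `GeomHoldsNQFnPxAt (frmChoiceAllQ3VPx D gv fv Pv Sv cv hv bv)` — for ALL slots (no floors), as in U

builds on p205010 (kernel theorem, internal audit signed; external expert review pending) — nothing in this file uses p205010; the first of the four GEN column tops the
U_s node reads by name (WAVE-Us-MANIFEST §5); NOTHING about the OPEN node U_s (`SamePDropOfSkeletonFrmScaled₁`) is claimed; no statement, no `@[conjecture]`, def-free.
Lane `prim-bschramm`, seat `prim-bschramm-gen-1` g0 (GEN pen); helper file (`--supports stmt-CriticalPhenomena-4575 --as helper`).  GEN hunk class (i) ONLY: the binder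
`h1 ↦ hP` in the `intro` line (unused by the proof, as `h1` was) and `hAt` now `AtQNQ` of the Px choice data `choiceAtQ3VPx … D …` — whose cells `ΓQV`, face data `FDQV`,
level data `LDQV` and every slot value read here are `choiceAtQ3V`'s by `rfl` («…DefsVPx»), and whose facts `hAt.1.factsO` feed `FactsO.shared` / `FactsO.clauses` exactly as
before (those read no seed level); the proof text after `intro` is the U twin's BYTE-IDENTICAL.  (The geometry of the anchored cells lives at the base type's own chart data —
no proxy, no `+ D`: proxies enter only the (R)/(C)/(F) INPUT events.) [cite: KozmaNitzan2024, §4 Theorem 6 (pp. 25–31)] [this work]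
-/

noncomputable section

open scoped Classical

namespace Summit.CriticalPhenomena.PercolationContinuityZ3.Theorems.Transplant

open MeasureTheory Literature.Probability.Percolation Literature.Probability.LatticeModels SimpleGraph KNCells KNLevels
open Literature.Barriers.CriticalPhenomena (HasExponentialGrowth)

namespace PlanarSkeletonFrmFrom

open SkelConc (Consts)
open Skelφ.StepI (DataN DataNS OutNS)

/-- **THE GEOMETRIC OBLIGATION OF THE GEN CHOICE FUNCTION OF RECORD AT PROXY RADIUS `D`** — for every box/width/pair/fibre/creep/room/arrival slot: root `t`, `K ≥ κ.K₀`,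
`RunGeom`, `AnchGeom`, `SepGeom₂`, `ExitGeom`, `StepsGeom`, `LevelGeom` of the anchored cells `ΓQV` with `FDQV`/`LDQV` at every `(O, q)` with `AtQNQ` (U's
`geomHoldsNQFn_frmChoiceAllQ3V`, proof verbatim over `geom_fineA_at_bV`). [cite: KozmaNitzan2024, §4 Theorem 6 (pp. 25–31)] -/
theorem geomHoldsNQFnPxAt_frmChoiceAllQ3VPx (D : ℕ) (gv fv : PlanarSkeletonFrmFrom.Neg.FSlot) (Pv : NegB.PSlot) (Sv : NegB.SSlot) (cv hv : NegB.CSlot) (bv : NegB.BSlot) :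
    GeomHoldsNQFnPxAt (frmChoiceAllQ3VPx D gv fv Pv Sv cv hv bv) := by
  intro κ V _ _ G _ Φ hg t ht hP p hp0 hp1 hC O q hAt
  obtain ⟨-, -, hR, -, -⟩ := Skelφ.StepI.OutO.FactsO.shared hAt.1.factsO
  obtain ⟨h1', h2, -, h4, h5, h6, h7, h8, h9⟩ := NegB.geom_fineA_at_bV κ Φ t p O.merged (NegB.gOf κ Φ t p O gv) (NegB.fOf κ Φ t p O fv)
    (NegB.cOf κ Φ t p O gv fv cv) (NegB.hOf κ Φ t p O gv fv hv)
    (NegB.lip_φL κ Φ t p O.D O.DT.toDataN O.ori (NegB.gOf κ Φ t p O gv) (NegB.fOf κ Φ t p O fv))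
    (NegB.steps_φL κ Φ t p O.D O.DT.toDataN O.ori (NegB.gOf κ Φ t p O gv) (NegB.fOf κ Φ t p O fv))
    (NegB.eqNumL_of_factsO κ Φ t p O.D O.DT.toDataN O.ori _ _ hR (Skelφ.StepI.OutO.FactsO.clauses hAt.1.factsO))
    (NegB.schedOfT_WFS2 κ Φ t p O.merged (NegB.gOf κ Φ t p O gv) (NegB.fOf κ Φ t p O fv) (NegB.cOf κ Φ t p O gv fv cv)
      (Sv κ Φ t p O.merged (NegB.gOf κ Φ t p O gv) (NegB.fOf κ Φ t p O fv) q))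
    (NegB.colQ_schedOfT κ Φ t p O.merged (NegB.gOf κ Φ t p O gv) (NegB.fOf κ Φ t p O fv) (NegB.cOf κ Φ t p O gv fv cv)
      (Sv κ Φ t p O.merged (NegB.gOf κ Φ t p O gv) (NegB.fOf κ Φ t p O fv) q))
    (NegB.bOf_leV κ Φ t p O gv fv cv hv bv)
  exact ⟨h1', h2, h4, h5, h6, h7, h8, h9⟩

end PlanarSkeletonFrmFrom

end Summit.CriticalPhenomena.PercolationContinuityZ3.Theorems.Transplant

end
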